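import Summits.AtomisticToContinuum.FouriersLaw.Theorems.VanishingNoiseTransferNoisyFourierThomsonWitnessCostsSitesAux3
import Summits.AtomisticToContinuum.FouriersLaw.Theorems.VanishingNoiseTransferNoisyFourierThomsonWitnessSites

/-!
# The site-structured costs of the Thomson witness, IV: the bath cost (h) and the bath part of the generator
(`--supports` file for crux `VanishingNoiseTransfer.NoisyFourier`, stmt-AtomisticToContinuum-11977, line
`abel-storage-decay`, stub B `stub_bulkAbelGKPositivity`; part W5a "WitnessL2Sites", file 4 of 4)

Setting as in parts I–III (`…CostsSitesAux1/2/3`); `v` the Thomson witness, `μ_T` the Gibbs measure of the pinned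
chain, `B_m = bathWeight L m = [m = 0] + [m = L − 1]`. Input: W3's momentum partials
`∂_{p_m} v = K_m + 2 p_m N_m`, `∂²_{p_m} v = 2 N_m` (`Algebra.partialP_thomsonWitness`,
`Algebra.partialP_partialP_thomsonWitness`, file `…ThomsonWitnessSites`).
* `exists_integral_sq_partialP_thomsonWitness_le` — `∫ (∂_{p_m} v)² dμ_T ≤ C` uniformly in `L`, `m`
  (`(K + 2pN)² ≤ 2K² + 2(2pN)²`, parts II–III);
* `sum_bathWeight_mul_integral_sq_partialP_le` — **(h) `Σ_m B_m ∫ (∂_{p_m} v)² dμ_T ≤ 2C`** (`Σ_m B_m = 2`);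
* `memLp_partialP_thomsonWitness`, `memLp_partialP_partialP_thomsonWitness`, `memLp_bath_thomsonWitness` —
  `∂_{p_m} v`, `∂²_{p_m} v` and the bath part of the generator `T ∂²_{p_b} v − p_b ∂_{p_b} v` are in `L²(μ_T)` for
  every site (growth `≤ C(1 + H)^k`, `pinnedChain_memLp_two_of_abs_le`);
* `helper_thomsonWitnessCostsSites` — REGISTERED: with ONE constant `c = c(ω₂, lam, β, T)`, for every `L ≥ 2`,
  `v ∈ L²(μ_T)`, (f) `∫ v² ≤ c(L − 1)`, (g) `Σ_m ∫ (v ∘ F_m − v)² ≤ c(L − 1)`, (h) `Σ_m B_m ∫ (∂_{p_m} v)² ≤ c(L − 1)`,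
  and `T ∂²_{p_b} v − p_b ∂_{p_b} v ∈ L²(μ_T)` for every `b` (conjuncts 1, 4, 5, 6 of the witness costs of stub B and
  the bath half of conjunct 3).
All statements are [folklore]; axioms `propext`, `Classical.choice`, `Quot.sound` only.
-/

noncomputable section

open MeasureTheory
open scoped BigOperators
open Literature.MathematicalPhysics.KineticTheory.HeatConduction
open Summit.AtomisticToContinuum.FouriersLaw.Cruxes.SuperadditiveResistance.InsertionToolbox
  (pinnedChain_memLp_two_of_abs_le)
open Summit.AtomisticToContinuum.FouriersLaw.Theorems.NoisyFourier.ThomsonWitness.Algebra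
  (partialP_thomsonWitness partialP_partialP_thomsonWitness)

namespace Summit.AtomisticToContinuum.FouriersLaw.Theorems.NoisyFourier.ThomsonWitness.Costs

variable {L : ℕ} {ω₂ lam β γ : ℝ}

/-! ### The momentum partials of the witness: `L²` membership, the bath cost (h), the bath part of the generator -/

section Bath

variable (hω : 0 < ω₂) (hl : 0 ≤ lam) (hβ : 0 ≤ β) (γ : ℝ) {T : ℝ} (hT : 0 < T)
include hω hl hβ hT

/-- **Uniform bound on the momentum partials of the witness**: `∫ (∂_{p_m} v)² dμ_T ≤ C` for every `L`, `m`
(`∂_{p_m} v = K_m + 2 p_m N_m`, `C = 2 C_K + 96 β T²`). [folklore] -/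
theorem exists_integral_sq_partialP_thomsonWitness_le : ∃ C : ℝ, 0 ≤ C ∧ ∀ (L : ℕ) (m : Fin L),
    Integrable (fun x : PhaseSpace L => (partialP m (fun y : PhaseSpace L => ∑ i : Fin L, ∑ j : Fin L,
      if j.val = i.val + 1 then
        (y.2 i * (y.2 j ^ 2 * (-(6 * β * (y.1 j - y.1 i)) / (1 + 3 * β * (y.1 j - y.1 i) ^ 2) ^ 2) -
            partialQ j ((pinnedChain ω₂ lam β γ).hamiltonian L) y * (1 / (1 + 3 * β * (y.1 j - y.1 i) ^ 2))) +
          y.2 j * (y.2 i ^ 2 * (-(6 * β * (y.1 j - y.1 i)) / (1 + 3 * β * (y.1 j - y.1 i) ^ 2) ^ 2) +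
            partialQ i ((pinnedChain ω₂ lam β γ).hamiltonian L) y * (1 / (1 + 3 * β * (y.1 j - y.1 i) ^ 2))))
      else 0) x) ^ 2) ((pinnedChain ω₂ lam β γ).gibbsMeasure L T) ∧
    ∫ x, (partialP m (fun y : PhaseSpace L => ∑ i : Fin L, ∑ j : Fin L, if j.val = i.val + 1 then
        (y.2 i * (y.2 j ^ 2 * (-(6 * β * (y.1 j - y.1 i)) / (1 + 3 * β * (y.1 j - y.1 i) ^ 2) ^ 2) -
            partialQ j ((pinnedChain ω₂ lam β γ).hamiltonian L) y * (1 / (1 + 3 * β * (y.1 j - y.1 i) ^ 2))) +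
          y.2 j * (y.2 i ^ 2 * (-(6 * β * (y.1 j - y.1 i)) / (1 + 3 * β * (y.1 j - y.1 i) ^ 2) ^ 2) +
            partialQ i ((pinnedChain ω₂ lam β γ).hamiltonian L) y * (1 / (1 + 3 * β * (y.1 j - y.1 i) ^ 2))))
      else 0) x) ^ 2 ∂((pinnedChain ω₂ lam β γ).gibbsMeasure L T) ≤ C := by
  obtain ⟨CK, hCK0, hCK⟩ := exists_integral_K_sq_le hω hl hβ γ hT
  refine ⟨2 * CK + 2 * (48 * β * T ^ 2), by positivity, fun L m => ?_⟩
  simp only [partialP_thomsonWitness hβ]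
  set μ := (pinnedChain ω₂ lam β γ).gibbsMeasure L T with hμ
  set K : PhaseSpace L → ℝ := fun x =>
      (∑ j : Fin L, if j.val = m.val + 1 then
        (x.2 j ^ 2 * (-(6 * β * (x.1 j - x.1 m)) / (1 + 3 * β * (x.1 j - x.1 m) ^ 2) ^ 2) -
          partialQ j ((pinnedChain ω₂ lam β γ).hamiltonian L) x * (1 / (1 + 3 * β * (x.1 j - x.1 m) ^ 2))) else 0) +
      (∑ i : Fin L, if m.val = i.val + 1 then
        (x.2 i ^ 2 * (-(6 * β * (x.1 m - x.1 i)) / (1 + 3 * β * (x.1 m - x.1 i) ^ 2) ^ 2) +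
          partialQ i ((pinnedChain ω₂ lam β γ).hamiltonian L) x * (1 / (1 + 3 * β * (x.1 m - x.1 i) ^ 2))) else 0)
    with hK
  set E : PhaseSpace L → ℝ := fun x => 2 * x.2 m *
      ((∑ j : Fin L, if j.val = m.val + 1 then
        x.2 j * (-(6 * β * (x.1 j - x.1 m)) / (1 + 3 * β * (x.1 j - x.1 m) ^ 2) ^ 2) else 0) +
      (∑ i : Fin L, if m.val = i.val + 1 then
        x.2 i * (-(6 * β * (x.1 m - x.1 i)) / (1 + 3 * β * (x.1 m - x.1 i) ^ 2) ^ 2) else 0)) with hE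
  have hIK : Integrable (fun x => K x ^ 2) μ ∧ ∫ x, K x ^ 2 ∂μ ≤ CK := hCK L m
  have hIE : Integrable (fun x => E x ^ 2) μ ∧ ∫ x, E x ^ 2 ∂μ ≤ 48 * β * T ^ 2 :=
    integral_sq_snd_mul_nbrSum_le hω hl hβ γ hT L m
  have hg : Integrable (fun x => 2 * K x ^ 2 + 2 * E x ^ 2) μ := (hIK.1.const_mul 2).add (hIE.1.const_mul 2)
  have hc : Continuous fun x => (K x + E x) ^ 2 :=
    ((continuous_K hβ m).add ((continuous_const.mul ((continuous_apply m).comp continuous_snd)).mul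
      (continuous_nbrSum hβ m))).pow 2
  show Integrable (fun x => (K x + E x) ^ 2) μ ∧ ∫ x, (K x + E x) ^ 2 ∂μ ≤ 2 * CK + 2 * (48 * β * T ^ 2)
  refine integrable_and_integral_le_of_le hc.aestronglyMeasurable hg (fun x => sq_nonneg _) (fun x => ?_) ?_
  · show (K x + E x) ^ 2 ≤ 2 * K x ^ 2 + 2 * E x ^ 2
    nlinarith [sq_nonneg (K x - E x)]
  · rw [integral_add (hIK.1.const_mul 2) (hIE.1.const_mul 2), integral_const_mul, integral_const_mul]
    linarith [hIK.2, hIE.2]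

/-- **The bath cost (h)**: `Σ_m B_m ∫ (∂_{p_m} v)² dμ_T ≤ 2C` for every `L ≥ 1` (only the two bath sites carry a
weight, `Σ_m B_m = 2`). [folklore] -/
theorem sum_bathWeight_mul_integral_sq_partialP_le : ∃ C : ℝ, 0 ≤ C ∧ ∀ (L : ℕ), 1 ≤ L →
    ∑ m : Fin L, OscillatorChain.bathWeight L m *
      ∫ x, (partialP m (fun y : PhaseSpace L => ∑ i : Fin L, ∑ j : Fin L, if j.val = i.val + 1 then
        (y.2 i * (y.2 j ^ 2 * (-(6 * β * (y.1 j - y.1 i)) / (1 + 3 * β * (y.1 j - y.1 i) ^ 2) ^ 2) -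
            partialQ j ((pinnedChain ω₂ lam β γ).hamiltonian L) y * (1 / (1 + 3 * β * (y.1 j - y.1 i) ^ 2))) +
          y.2 j * (y.2 i ^ 2 * (-(6 * β * (y.1 j - y.1 i)) / (1 + 3 * β * (y.1 j - y.1 i) ^ 2) ^ 2) +
            partialQ i ((pinnedChain ω₂ lam β γ).hamiltonian L) y * (1 / (1 + 3 * β * (y.1 j - y.1 i) ^ 2))))
      else 0) x) ^ 2 ∂((pinnedChain ω₂ lam β γ).gibbsMeasure L T) ≤ C := by
  obtain ⟨C, hC0, hC⟩ := exists_integral_sq_partialP_thomsonWitness_le hω hl hβ γ hT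
  refine ⟨2 * C, by positivity, fun L hL => ?_⟩
  calc _ ≤ ∑ m : Fin L, OscillatorChain.bathWeight L m * C :=
        Finset.sum_le_sum fun m _ => mul_le_mul_of_nonneg_left (hC L m).2 (bathWeight_nonneg L m)
    _ = 2 * C := by rw [← Finset.sum_mul, OscillatorChain.sum_bathWeight (by omega)]

/-- **`∂_{p_m} v ∈ L²(μ_T)`**. [folklore] -/
theorem memLp_partialP_thomsonWitness (L : ℕ) (m : Fin L) :
    MemLp (partialP m (fun y : PhaseSpace L => ∑ i : Fin L, ∑ j : Fin L, if j.val = i.val + 1 then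
        (y.2 i * (y.2 j ^ 2 * (-(6 * β * (y.1 j - y.1 i)) / (1 + 3 * β * (y.1 j - y.1 i) ^ 2) ^ 2) -
            partialQ j ((pinnedChain ω₂ lam β γ).hamiltonian L) y * (1 / (1 + 3 * β * (y.1 j - y.1 i) ^ 2))) +
          y.2 j * (y.2 i ^ 2 * (-(6 * β * (y.1 j - y.1 i)) / (1 + 3 * β * (y.1 j - y.1 i) ^ 2) ^ 2) +
            partialQ i ((pinnedChain ω₂ lam β γ).hamiltonian L) y * (1 / (1 + 3 * β * (y.1 j - y.1 i) ^ 2))))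
      else 0)) 2 ((pinnedChain ω₂ lam β γ).gibbsMeasure L T) := by
  rw [show partialP m (fun y : PhaseSpace L => ∑ i : Fin L, ∑ j : Fin L, if j.val = i.val + 1 then
        (y.2 i * (y.2 j ^ 2 * (-(6 * β * (y.1 j - y.1 i)) / (1 + 3 * β * (y.1 j - y.1 i) ^ 2) ^ 2) -
            partialQ j ((pinnedChain ω₂ lam β γ).hamiltonian L) y * (1 / (1 + 3 * β * (y.1 j - y.1 i) ^ 2))) +
          y.2 j * (y.2 i ^ 2 * (-(6 * β * (y.1 j - y.1 i)) / (1 + 3 * β * (y.1 j - y.1 i) ^ 2) ^ 2) +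
            partialQ i ((pinnedChain ω₂ lam β γ).hamiltonian L) y * (1 / (1 + 3 * β * (y.1 j - y.1 i) ^ 2))))
      else 0) = _ from funext fun x => partialP_thomsonWitness hβ m x]
  obtain ⟨C, hC0, hC⟩ := exists_abs_K_le hω hl hβ γ
  refine pinnedChain_memLp_two_of_abs_le hω hl hβ γ L hT
    ((continuous_K hβ m).add ((continuous_const.mul ((continuous_apply m).comp continuous_snd)).mul
      (continuous_nbrSum hβ m))) (C := C + 16 * (1 + 3 * β)) (k := 3) fun x => ?_
  set M := 1 + (pinnedChain ω₂ lam β γ).hamiltonian L x with hM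
  have hM1 : 1 ≤ M := one_le_one_add_hamiltonian hω hl hβ γ x
  have h1 := hC L m x
  have h2 := abs_nbrSum_le hω hl hβ γ m x
  have h3 := abs_snd_le hω hl hβ γ x m
  have hM23 : M ^ 2 ≤ M ^ 3 := pow_le_pow_right₀ hM1 (by norm_num)
  refine (abs_add_le _ _).trans ?_
  rw [abs_mul, abs_mul, abs_two]
  have h4 : 2 * |x.2 m| * |(∑ j : Fin L, if j.val = m.val + 1 then
        x.2 j * (-(6 * β * (x.1 j - x.1 m)) / (1 + 3 * β * (x.1 j - x.1 m) ^ 2) ^ 2) else 0) +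
      (∑ i : Fin L, if m.val = i.val + 1 then
        x.2 i * (-(6 * β * (x.1 m - x.1 i)) / (1 + 3 * β * (x.1 m - x.1 i) ^ 2) ^ 2) else 0)| ≤
      2 * (2 * M) * (4 * (1 + 3 * β) * M) :=
    mul_le_mul (by linarith) h2 (abs_nonneg _) (by positivity)
  nlinarith [mul_le_mul_of_nonneg_left hM23 (by positivity : (0 : ℝ) ≤ 16 * (1 + 3 * β))]

/-- **`∂²_{p_m} v ∈ L²(μ_T)`** (`∂²_{p_m} v = 2 N_m`). [folklore] -/
theorem memLp_partialP_partialP_thomsonWitness (L : ℕ) (m : Fin L) :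
    MemLp (partialP m (partialP m (fun y : PhaseSpace L => ∑ i : Fin L, ∑ j : Fin L, if j.val = i.val + 1 then
        (y.2 i * (y.2 j ^ 2 * (-(6 * β * (y.1 j - y.1 i)) / (1 + 3 * β * (y.1 j - y.1 i) ^ 2) ^ 2) -
            partialQ j ((pinnedChain ω₂ lam β γ).hamiltonian L) y * (1 / (1 + 3 * β * (y.1 j - y.1 i) ^ 2))) +
          y.2 j * (y.2 i ^ 2 * (-(6 * β * (y.1 j - y.1 i)) / (1 + 3 * β * (y.1 j - y.1 i) ^ 2) ^ 2) +
            partialQ i ((pinnedChain ω₂ lam β γ).hamiltonian L) y * (1 / (1 + 3 * β * (y.1 j - y.1 i) ^ 2))))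
      else 0))) 2 ((pinnedChain ω₂ lam β γ).gibbsMeasure L T) := by
  rw [show partialP m (partialP m (fun y : PhaseSpace L => ∑ i : Fin L, ∑ j : Fin L, if j.val = i.val + 1 then
        (y.2 i * (y.2 j ^ 2 * (-(6 * β * (y.1 j - y.1 i)) / (1 + 3 * β * (y.1 j - y.1 i) ^ 2) ^ 2) -
            partialQ j ((pinnedChain ω₂ lam β γ).hamiltonian L) y * (1 / (1 + 3 * β * (y.1 j - y.1 i) ^ 2))) +
          y.2 j * (y.2 i ^ 2 * (-(6 * β * (y.1 j - y.1 i)) / (1 + 3 * β * (y.1 j - y.1 i) ^ 2) ^ 2) +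
            partialQ i ((pinnedChain ω₂ lam β γ).hamiltonian L) y * (1 / (1 + 3 * β * (y.1 j - y.1 i) ^ 2))))
      else 0)) = _ from funext fun x => partialP_partialP_thomsonWitness hβ m x]
  refine pinnedChain_memLp_two_of_abs_le hω hl hβ γ L hT (continuous_const.mul (continuous_nbrSum hβ m))
    (C := 8 * (1 + 3 * β)) (k := 1) fun x => ?_
  rw [abs_mul, abs_two, pow_one]
  have h2 := abs_nbrSum_le hω hl hβ γ m x
  linarith

/-- **The bath part of the generator applied to the witness is in `L²(μ_T)`**: for every site `b` (in particular the
bath sites `b = 0`, `b = L − 1`), `T ∂²_{p_b} v − p_b ∂_{p_b} v ∈ L²(μ_T)`. [folklore] -/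
theorem memLp_bath_thomsonWitness (L : ℕ) (b : Fin L) :
    MemLp (fun x : PhaseSpace L =>
      T * partialP b (partialP b (fun y : PhaseSpace L => ∑ i : Fin L, ∑ j : Fin L, if j.val = i.val + 1 then
        (y.2 i * (y.2 j ^ 2 * (-(6 * β * (y.1 j - y.1 i)) / (1 + 3 * β * (y.1 j - y.1 i) ^ 2) ^ 2) -
            partialQ j ((pinnedChain ω₂ lam β γ).hamiltonian L) y * (1 / (1 + 3 * β * (y.1 j - y.1 i) ^ 2))) +
          y.2 j * (y.2 i ^ 2 * (-(6 * β * (y.1 j - y.1 i)) / (1 + 3 * β * (y.1 j - y.1 i) ^ 2) ^ 2) +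
            partialQ i ((pinnedChain ω₂ lam β γ).hamiltonian L) y * (1 / (1 + 3 * β * (y.1 j - y.1 i) ^ 2))))
      else 0)) x -
      x.2 b * partialP b (fun y : PhaseSpace L => ∑ i : Fin L, ∑ j : Fin L, if j.val = i.val + 1 then
        (y.2 i * (y.2 j ^ 2 * (-(6 * β * (y.1 j - y.1 i)) / (1 + 3 * β * (y.1 j - y.1 i) ^ 2) ^ 2) -
            partialQ j ((pinnedChain ω₂ lam β γ).hamiltonian L) y * (1 / (1 + 3 * β * (y.1 j - y.1 i) ^ 2))) +
          y.2 j * (y.2 i ^ 2 * (-(6 * β * (y.1 j - y.1 i)) / (1 + 3 * β * (y.1 j - y.1 i) ^ 2) ^ 2) +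
            partialQ i ((pinnedChain ω₂ lam β γ).hamiltonian L) y * (1 / (1 + 3 * β * (y.1 j - y.1 i) ^ 2))))
      else 0) x) 2 ((pinnedChain ω₂ lam β γ).gibbsMeasure L T) := by
  refine ((memLp_partialP_partialP_thomsonWitness hω hl hβ γ hT L b).const_mul T).sub ?_
  simp only [partialP_thomsonWitness hβ]
  obtain ⟨C, hC0, hC⟩ := exists_abs_K_le hω hl hβ γ
  refine pinnedChain_memLp_two_of_abs_le hω hl hβ γ L hT
    (((continuous_apply b).comp continuous_snd).mul ((continuous_K hβ b).add
      ((continuous_const.mul ((continuous_apply b).comp continuous_snd)).mul (continuous_nbrSum hβ b))))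
    (C := 2 * (C + 16 * (1 + 3 * β))) (k := 4) fun x => ?_
  set M := 1 + (pinnedChain ω₂ lam β γ).hamiltonian L x with hM
  have hM1 : 1 ≤ M := one_le_one_add_hamiltonian hω hl hβ γ x
  have h1 := hC L b x
  have h2 := abs_nbrSum_le hω hl hβ γ b x
  have h3 := abs_snd_le hω hl hβ γ x b
  have hM23 : M ^ 2 ≤ M ^ 3 := pow_le_pow_right₀ hM1 (by norm_num)
  rw [abs_mul]
  have h4 : |(∑ j : Fin L, if j.val = b.val + 1 then
        (x.2 j ^ 2 * (-(6 * β * (x.1 j - x.1 b)) / (1 + 3 * β * (x.1 j - x.1 b) ^ 2) ^ 2) -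
          partialQ j ((pinnedChain ω₂ lam β γ).hamiltonian L) x * (1 / (1 + 3 * β * (x.1 j - x.1 b) ^ 2))) else 0) +
      (∑ i : Fin L, if b.val = i.val + 1 then
        (x.2 i ^ 2 * (-(6 * β * (x.1 b - x.1 i)) / (1 + 3 * β * (x.1 b - x.1 i) ^ 2) ^ 2) +
          partialQ i ((pinnedChain ω₂ lam β γ).hamiltonian L) x * (1 / (1 + 3 * β * (x.1 b - x.1 i) ^ 2))) else 0) +
      2 * x.2 b * ((∑ j : Fin L, if j.val = b.val + 1 then
        x.2 j * (-(6 * β * (x.1 j - x.1 b)) / (1 + 3 * β * (x.1 j - x.1 b) ^ 2) ^ 2) else 0) +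
      (∑ i : Fin L, if b.val = i.val + 1 then
        x.2 i * (-(6 * β * (x.1 b - x.1 i)) / (1 + 3 * β * (x.1 b - x.1 i) ^ 2) ^ 2) else 0))| ≤
      (C + 16 * (1 + 3 * β)) * M ^ 3 := by
    refine (abs_add_le _ _).trans ?_
    rw [abs_mul, abs_mul, abs_two]
    have h5 : 2 * |x.2 b| * |(∑ j : Fin L, if j.val = b.val + 1 then
        x.2 j * (-(6 * β * (x.1 j - x.1 b)) / (1 + 3 * β * (x.1 j - x.1 b) ^ 2) ^ 2) else 0) +
      (∑ i : Fin L, if b.val = i.val + 1 then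
        x.2 i * (-(6 * β * (x.1 b - x.1 i)) / (1 + 3 * β * (x.1 b - x.1 i) ^ 2) ^ 2) else 0)| ≤
        2 * (2 * M) * (4 * (1 + 3 * β) * M) :=
      mul_le_mul (by linarith) h2 (abs_nonneg _) (by positivity)
    nlinarith [mul_le_mul_of_nonneg_left hM23 (by positivity : (0 : ℝ) ≤ 16 * (1 + 3 * β))]
  calc _ ≤ (2 * M) * ((C + 16 * (1 + 3 * β)) * M ^ 3) := mul_le_mul h3 h4 (abs_nonneg _) (by positivity)
    _ = _ := by ring

end Bath

/-! ### Registered helper: the site-structured costs of the Thomson witness -/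

/-- Registered helper sub-goal `helper_thomsonWitnessCostsSites` of crux stmt-AtomisticToContinuum-11977 (line
`abel-storage-decay`, stub B `stub_bulkAbelGKPositivity`, part W5a): for the Thomson witness `v` of the pinned chain
and ONE constant `c = c(ω₂, lam, β, T)`, for every `L ≥ 2`: `v ∈ L²(μ_T)`; (f) `∫ v² dμ_T ≤ c (L − 1)`;
(g) `Σ_m ∫ (v ∘ F_m − v)² dμ_T ≤ c (L − 1)`; (h) `Σ_m B_m ∫ (∂_{p_m} v)² dμ_T ≤ c (L − 1)`; and the bath part of the
generator applied to `v`, `T ∂²_{p_b} v − p_b ∂_{p_b} v`, is in `L²(μ_T)` for every site `b`. [folklore] -/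
theorem helper_thomsonWitnessCostsSites : ∀ (ω₂ lam β γ T : ℝ), 0 < ω₂ → 0 < lam → 0 < β → 0 < γ → 0 < T → ∃ c : ℝ, ∀ (L : ℕ), 2 ≤ L → let v : Literature.MathematicalPhysics.KineticTheory.HeatConduction.PhaseSpace L → ℝ := fun x => ∑ i : Fin L, ∑ j : Fin L, if j.val = i.val + 1 then (x.2 i * (x.2 j ^ 2 * (-(6 * β * (x.1 j - x.1 i)) / (1 + 3 * β * (x.1 j - x.1 i) ^ 2) ^ 2) - Literature.MathematicalPhysics.KineticTheory.HeatConduction.partialQ j ((Literature.MathematicalPhysics.KineticTheory.HeatConduction.pinnedChain ω₂ lam β γ).hamiltonian L) x * (1 / (1 + 3 * β * (x.1 j - x.1 i) ^ 2))) + x.2 j * (x.2 i ^ 2 * (-(6 * β * (x.1 j - x.1 i)) / (1 + 3 * β * (x.1 j - x.1 i) ^ 2) ^ 2) + Literature.MathematicalPhysics.KineticTheory.HeatConduction.partialQ i ((Literature.MathematicalPhysics.KineticTheory.HeatConduction.pinnedChain ω₂ lam β γ).hamiltonian L) x * (1 / (1 + 3 * β * (x.1 j - x.1 i) ^ 2))))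 else 0; MeasureTheory.MemLp v 2 ((Literature.MathematicalPhysics.KineticTheory.HeatConduction.pinnedChain ω₂ lam β γ).gibbsMeasure L T) ∧ MeasureTheory.integral ((Literature.MathematicalPhysics.KineticTheory.HeatConduction.pinnedChain ω₂ lam β γ).gibbsMeasure L T) (fun x => v x ^ 2) ≤ c * ((L : ℝ) - 1) ∧ ∑ i : Fin L, MeasureTheory.integral ((Literature.MathematicalPhysics.KineticTheory.HeatConduction.pinnedChain ω₂ lam β γ).gibbsMeasure L T) (fun x => (v (Literature.MathematicalPhysics.KineticTheory.HeatConduction.momentumFlip i x) - v x) ^ 2) ≤ c * ((L : ℝ) - 1) ∧ ∑ i : Fin L, Literature.MathematicalPhysics.KineticTheory.HeatConduction.OscillatorChain.bathWeight L i * MeasureTheory.integral ((Literature.MathematicalPhysics.KineticTheory.HeatConduction.pinnedChain ω₂ lam β γ).gibbsMeasure L T) (fun x => Literature.MathematicalPhysics.KineticTheory.HeatConduction.partialP i v x ^ 2) ≤ c * ((L : ℝ) - 1) ∧ ∀ b : Fin L, MeasureTheory.MemLp (fun x => T * Literature.MathematicalPhysics.KineticTheory.HeatConduction.partialP b (Literature.MathematicalPhysics.KineticTheory.HeatConduction.partialP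 b v) x - x.2 b * Literature.MathematicalPhysics.KineticTheory.HeatConduction.partialP b v x) 2 ((Literature.MathematicalPhysics.KineticTheory.HeatConduction.pinnedChain ω₂ lam β γ).gibbsMeasure L T) := by
  intro ω₂ lam β γ T hω hl hβ _hγ hT
  obtain ⟨c₁, hc₁0, hc₁⟩ := exists_thomsonWitness_site_costs hω hl.le hβ.le γ hT
  obtain ⟨c₂, hc₂0, hc₂⟩ := sum_bathWeight_mul_integral_sq_partialP_le hω hl.le hβ.le γ hT
  refine ⟨c₁ + c₂, fun L hL => ?_⟩
  intro v
  have hL1 : (1 : ℝ) ≤ (L : ℝ) - 1 := by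
    have : (2 : ℝ) ≤ L := by exact_mod_cast hL
    linarith
  obtain ⟨hf, hg⟩ := hc₁ L hL
  have hh := hc₂ L (by omega)
  refine ⟨memLp_thomsonWitness hω hl.le hβ.le γ hT L, ?_, ?_, ?_, fun b => memLp_bath_thomsonWitness hω hl.le hβ.le γ hT L b⟩
  · exact hf.trans (by nlinarith)
  · exact hg.trans (by nlinarith)
  · exact hh.trans (by nlinarith)

end Summit.AtomisticToContinuum.FouriersLaw.Theorems.NoisyFourier.ThomsonWitness.Costs

end
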